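import Literature.Analysis.FunctionSpaces.TorusLinearisedNSEnergy
import HarnessLib

/-!
# The linearised Navier–Stokes equation along a smooth field on the flat torus, III:
# `L²` growth bounds pass to `L²`-limits of the data (continuous dependence)

Function-space support file (all results proved; no definitions, no named facts), sequel of
`TorusLinearisedNSEnergy` / `TorusLinearisedNSGrowth` (energy identity, Grönwall bound
`∫‖w(t)‖² ≤ ∫‖w(a)‖² · e^{2(ΣCᵢ)(t−a)}`, uniqueness, linearity `linearisedNS_sub_eq` for jointly smooth
solutions `(w, q)` of `∂ₜw + (u·∇)w + (w·∇)u = νΔw − ∇q`, `div w = 0`, along a jointly smooth `u` with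
divergence-free slices on `[a, b] × 𝕋^d`; Constantin–Foias 1988 Ch. 14 (14.2)–(14.6), Temam 1997 Ch. VI
§3.1 (3.7)–(3.11)).  As there, no predicate is introduced; the clauses of a classical linearised solution
are unbundled hypotheses.

* `Torus.integral_norm_sq_add_le_eps` — the elementary `ε`-form of Minkowski's inequality in `L²(𝕋^d)`:
  `ε ∫‖f + g‖² ≤ ε(1+ε) ∫‖f‖² + (1+ε) ∫‖g‖²` (`ε > 0`), i.e. `‖f+g‖² ≤ (1+ε)‖f‖² + (1+1/ε)‖g‖²`.
* **`Torus.linearisedNS_integral_norm_sq_le_of_tendsto`** — CONTINUOUS DEPENDENCE TRANSPORTS GROWTH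
  BOUNDS: if `(wₙ, qₙ)` are classical linearised solutions on `[a, b]` along `u` whose data converge to the
  datum of the classical solution `(w, q)` in `L²` (`∫‖w(a) − wₙ(a)‖² → 0`) and each obeys
  `∫‖wₙ(t)‖² ≤ K ∫‖wₙ(a)‖²` (`K ≥ 0`) at some `t ∈ [a, b]`, then `∫‖w(t)‖² ≤ K ∫‖w(a)‖²`.  Proof: the
  differences `w − wₙ` are classical solutions (`linearisedNS_sub_eq`), so by the Grönwall bound
  (`linearisedNS_integral_norm_sq_le_mul_exp`, derivative bounds of `u` by compactness) their energy at
  time `t` is `≤ e^{2(ΣC)(t−a)} ∫‖w(a) − wₙ(a)‖² → 0`; the `ε`-Minkowski inequality at times `t` and `a` and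
  the two limits `n → ∞`, `ε → 0⁺` conclude (Temam 1997, Ch. III §3.1 Thm 3.1: continuous dependence of the
  linear evolution problem on the data; here in the explicit form needed to pass per-mode bounds to
  infinite superpositions).

Motivation (cell `ad-ideate`, K2″ stmt-AnomalousDissipation-19696, line `phase-cocycle`): the companion file
`FluidPDE/TorusLinearisedNSShearModesSuperposition` reduces `L²` growth bounds for data of FINITE
streamwise bandwidth to one harmonic at a time; a residual comb `g(xᵢ) eⱼ` with `g` smooth has infinitely
many harmonics, and this file passes the bound to it through its Fourier truncations (the truncated
combs are trigonometric polynomials, their solutions exist by `Torus.linearisedNS_exists`, and the data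
converge in `L²` by Parseval on `𝕋¹`).

## Mathlib / tree search

Tree (reused): `Torus.linearisedNS_integral_norm_sq_le_mul_exp`, `Torus.linearisedNS_sub_eq`,
`Torus.IsSmoothSpaceTimeOn.sub/.partialDeriv`, `Torus.divergence_sub`, `Torus.IsSmooth.norm_sq/.add`;
`lean search 'continuous dependence.*linearised|tendsto.*linearisedNS|le_of_tendsto.*integral_norm'`:
nothing of this shape. Mathlib: `ge_of_tendsto`, `Filter.Tendsto.const_mul`, `nhdsWithin` at `0⁺`,
`norm_add_le`, `nlinarith`.

## References

* R. Temam, *Infinite-Dimensional Dynamical Systems in Mechanics and Physics*, 2nd ed., Springer 1997,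
  Ch. VI §3.1 (3.7)–(3.11) (the linearised Navier–Stokes problem); Ch. III §3.1 (linear evolution problems).
  [`Temam1997`]
* P. Constantin, C. Foias, *Navier–Stokes Equations*, Univ. Chicago Press 1988, Ch. 14 (14.2)–(14.6).
  [`ConstantinFoiasNSE1988`]
-/

noncomputable section

open MeasureTheory Set Filter
open scoped InnerProductSpace ContDiff Topology

namespace Literature.Analysis.FunctionSpaces

namespace Torus

variable {d : Type*} [Fintype d] [DecidableEq d]

/-! ### The `ε`-form of Minkowski's inequality in `L²(𝕋^d)` -/

omit [Fintype d] [DecidableEq d] in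
/-- `ε‖x + y‖² ≤ ε(1+ε)‖x‖² + (1+ε)‖y‖²` in a real normed space (`2ε‖x‖‖y‖ ≤ ε²‖x‖² + ‖y‖²`). [folklore] -/
private theorem norm_add_sq_le_eps {E : Type*} [NormedAddCommGroup E] (x y : E) {ε : ℝ} (hε : 0 < ε) :
    ε * ‖x + y‖ ^ 2 ≤ ε * (1 + ε) * ‖x‖ ^ 2 + (1 + ε) * ‖y‖ ^ 2 := by
  have h1 : ‖x + y‖ ^ 2 ≤ (‖x‖ + ‖y‖) ^ 2 := by
    gcongr
    exact norm_add_le x y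
  nlinarith [mul_le_mul_of_nonneg_left h1 hε.le, sq_nonneg (ε * ‖x‖ - ‖y‖), norm_nonneg x,
    norm_nonneg y]

omit [DecidableEq d] in
/-- **`ε`-Minkowski in `L²(𝕋^d)`**: for smooth `f, g : 𝕋^d → F` and `ε > 0`,
`ε ∫‖f + g‖² ≤ ε(1+ε) ∫‖f‖² + (1+ε) ∫‖g‖²` (the Peter–Paul / Young form of the triangle inequality used
in energy estimates). [cite: Temam1997, Ch. III §1.1 (Young's inequality ab ≤ εa² + b²/(4ε) in the energy estimates)] -/
theorem integral_norm_sq_add_le_eps {F : Type*} [NormedAddCommGroup F] [InnerProductSpace ℝ F]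
    {f g : UnitAddTorus d → F} (hf : IsSmooth f) (hg : IsSmooth g) {ε : ℝ} (hε : 0 < ε) :
    ε * ∫ x, ‖f x + g x‖ ^ 2 ≤ ε * (1 + ε) * (∫ x, ‖f x‖ ^ 2) + (1 + ε) * ∫ x, ‖g x‖ ^ 2 := by
  have hfg : IsSmooth (fun x => f x + g x) := hf.add hg
  have i1 : Integrable (fun x => ‖f x + g x‖ ^ 2) volume := hfg.norm_sq.integrable
  have i2 : Integrable (fun x => ‖f x‖ ^ 2) volume := hf.norm_sq.integrable
  have i3 : Integrable (fun x => ‖g x‖ ^ 2) volume := hg.norm_sq.integrable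
  rw [← integral_const_mul, ← integral_const_mul, ← integral_const_mul,
    ← integral_add (i2.const_mul _) (i3.const_mul _)]
  exact integral_mono (i1.const_mul _) ((i2.const_mul _).add (i3.const_mul _))
    fun x => norm_add_sq_le_eps (f x) (g x) hε

/-! ### Growth bounds pass to `L²`-limits of the data -/

section DataLimit

variable {a b ν : ℝ} {u w : ℝ → UnitAddTorus d → EuclideanSpace ℝ d} {q : ℝ → UnitAddTorus d → ℝ}

/-- **Continuous dependence transports `L²` growth bounds to limits of the data.** Let `u` be jointly
smooth with divergence-free slices on `[a, b] × 𝕋^d` (`a < b`, `ν ≥ 0`), `(w, q)` a classical solution of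
the linearised Navier–Stokes system along `u`, and `(wₙ, qₙ)` classical solutions along `u` with
`∫‖w(a) − wₙ(a)‖² → 0`.  If at some `t ∈ [a, b]` every `wₙ` obeys `∫‖wₙ(t)‖² ≤ K ∫‖wₙ(a)‖²` with
`K ≥ 0`, then `∫‖w(t)‖² ≤ K ∫‖w(a)‖²`. [cite: Temam1997, Ch. VI §3.1 (3.11) (well-posedness of the linearised problem; continuous dependence)] -/
theorem linearisedNS_integral_norm_sq_le_of_tendsto (hν : 0 ≤ ν) (hab : a < b)
    (hu : IsSmoothSpaceTimeOn (Icc a b) u) (hudiv : ∀ t ∈ Icc a b, IsDivFree (u t))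
    (hw : IsSmoothSpaceTimeOn (Icc a b) w) (hq : IsSmoothSpaceTimeOn (Icc a b) q)
    (hwdiv : ∀ t ∈ Icc a b, IsDivFree (w t))
    (hlin : ∀ t ∈ Icc a b, ∀ x, timeDerivWithin (Icc a b) w t x + convect (u t) (w t) x +
      convect (w t) (u t) x = ν • laplacian (w t) x - gradient (q t) x)
    {wn : ℕ → ℝ → UnitAddTorus d → EuclideanSpace ℝ d} {qn : ℕ → ℝ → UnitAddTorus d → ℝ}
    (hwn : ∀ n, IsSmoothSpaceTimeOn (Icc a b) (wn n)) (hqn : ∀ n, IsSmoothSpaceTimeOn (Icc a b) (qn n))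
    (hwndiv : ∀ n, ∀ t ∈ Icc a b, IsDivFree (wn n t))
    (hlinn : ∀ n, ∀ t ∈ Icc a b, ∀ x, timeDerivWithin (Icc a b) (wn n) t x + convect (u t) (wn n t) x +
      convect (wn n t) (u t) x = ν • laplacian (wn n t) x - gradient (qn n t) x)
    (happrox : Tendsto (fun n => ∫ x, ‖w a x - wn n a x‖ ^ 2) atTop (𝓝 0))
    {K : ℝ} (hK0 : 0 ≤ K) {t : ℝ} (ht : t ∈ Icc a b)
    (hK : ∀ n, ∫ x, ‖wn n t x‖ ^ 2 ≤ K * ∫ x, ‖wn n a x‖ ^ 2) :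
    ∫ x, ‖w t x‖ ^ 2 ≤ K * ∫ x, ‖w a x‖ ^ 2 := by
  classical
  have hU : UniqueDiffOn ℝ (Icc a b) := uniqueDiffOn_Icc hab
  have ha : a ∈ Icc a b := left_mem_Icc.2 hab.le
  -- derivative bounds of the background (compactness) and the Grönwall factor
  obtain ⟨C, hC⟩ : ∃ C : d → ℝ, ∀ i, ∀ s ∈ Icc a b, ∀ x, ‖partialDeriv i (u s) x‖ ≤ C i := by
    have hbd : ∀ i : d, ∃ c : ℝ, ∀ s ∈ Icc a b, ∀ x, ‖partialDeriv i (u s) x‖ ≤ c := fun i =>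
      (hu.partialDeriv hU i).exists_norm_le_of_isCompact isCompact_Icc subset_rfl
    choose C hC using hbd
    exact ⟨C, hC⟩
  set E : ℝ := Real.exp ((2 * ∑ i, C i) * (t - a)) with hE
  have hE0 : 0 ≤ E := (Real.exp_pos _).le
  -- the differences `D n = w - wn n` are classical solutions with small data
  set D : ℕ → ℝ → UnitAddTorus d → EuclideanSpace ℝ d := fun n s y => w s y - wn n s y with hD
  have hDs : ∀ n, IsSmoothSpaceTimeOn (Icc a b) (D n) := fun n => hw.sub (hwn n)
  have hDdiv : ∀ n, ∀ s ∈ Icc a b, IsDivFree (D n s) := by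
    intro n s hs x
    have h12 : D n s = w s - wn n s := rfl
    rw [h12, divergence_sub ((hw.isSmooth_slice hs).isContDiff (by simp))
      (((hwn n).isSmooth_slice hs).isContDiff (by simp)), hwdiv s hs x, hwndiv n s hs x, sub_zero]
  have hDlin : ∀ n, ∀ s ∈ Icc a b, ∀ x, timeDerivWithin (Icc a b) (D n) s x + convect (u s) (D n s) x +
      convect (D n s) (u s) x =
        ν • laplacian (D n s) x - gradient (fun y => q s y - qn n s y) x :=
    fun n s hs x => linearisedNS_sub_eq hw hq hlin (hwn n) (hqn n) (hlinn n) hab hs x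
  have hDgrowth : ∀ n, ∫ x, ‖D n t x‖ ^ 2 ≤ (∫ x, ‖D n a x‖ ^ 2) * E := fun n =>
    linearisedNS_integral_norm_sq_le_mul_exp hν hu hudiv (hDs n) ((hq.sub (hqn n))) (hDdiv n) (hDlin n)
      hC ht
  -- abbreviations
  set A : ℝ := ∫ x, ‖w a x‖ ^ 2 with hA
  set T : ℝ := ∫ x, ‖w t x‖ ^ 2 with hT
  set δ : ℕ → ℝ := fun n => ∫ x, ‖D n a x‖ ^ 2 with hδ
  have hδt : Tendsto δ atTop (𝓝 0) := by simpa [hδ, hD] using happrox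
  have hA0 : 0 ≤ A := integral_nonneg fun _ => by positivity
  -- the `ε`-inequality for every `ε > 0`: `T ≤ (1+ε)² K A`
  have hε_ineq : ∀ ε : ℝ, 0 < ε → T ≤ (1 + ε) ^ 2 * K * A := by
    intro ε hε
    have hε1 : 0 ≤ 1 + ε := by linarith
    -- step at time `t`: `w t = wn n t + D n t`
    have step_t : ∀ n, ε * T ≤ ε * (1 + ε) * (∫ x, ‖wn n t x‖ ^ 2) + (1 + ε) * ∫ x, ‖D n t x‖ ^ 2 := by
      intro n
      have h := integral_norm_sq_add_le_eps ((hwn n).isSmooth_slice ht) ((hDs n).isSmooth_slice ht) hε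
      have hfun : (fun x => ‖wn n t x + D n t x‖ ^ 2) = fun x => ‖w t x‖ ^ 2 := by
        funext x; simp [hD]
      rw [hfun] at h
      exact h
    -- step at time `a`: `wn n a = w a + (-(D n a))`
    have step_a : ∀ n, ε * (∫ x, ‖wn n a x‖ ^ 2) ≤ ε * (1 + ε) * A + (1 + ε) * δ n := by
      intro n
      have h := integral_norm_sq_add_le_eps (hw.isSmooth_slice ha) (((hDs n).isSmooth_slice ha).neg) hε
      have hfun : (fun x => ‖w a x + (-(D n a)) x‖ ^ 2) = fun x => ‖wn n a x‖ ^ 2 := by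
        funext x; simp [hD]
      have hfun' : (fun x => ‖(-(D n a)) x‖ ^ 2) = fun x => ‖D n a x‖ ^ 2 := by
        funext x; simp
      rw [hfun, hfun'] at h
      exact h
    -- combine: `ε² T ≤ ε² (1+ε)² K A + cst · δ n` for every `n`
    have comb : ∀ n, ε * (ε * T) ≤ ε * (ε * ((1 + ε) ^ 2 * K * A)) +
        (ε * (1 + ε) ^ 2 * K + ε * (1 + ε) * E) * δ n := by
      intro n
      set P : ℝ := ∫ x, ‖wn n t x‖ ^ 2 with hP
      set B : ℝ := ∫ x, ‖wn n a x‖ ^ 2 with hB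
      set G : ℝ := ∫ x, ‖D n t x‖ ^ 2 with hG
      have h1 : ε * T ≤ ε * (1 + ε) * P + (1 + ε) * G := step_t n
      have h2 : ε * B ≤ ε * (1 + ε) * A + (1 + ε) * δ n := step_a n
      have h3 : G ≤ δ n * E := hDgrowth n
      have h4 : P ≤ K * B := hK n
      have h1' : ε * (ε * T) ≤ ε * (ε * (1 + ε) * P + (1 + ε) * G) :=
        mul_le_mul_of_nonneg_left h1 hε.le
      have h5' : ε * (ε * (1 + ε)) * P ≤ ε * (ε * (1 + ε)) * (K * B) :=
        mul_le_mul_of_nonneg_left h4 (by positivity)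
      have h6' : ε * (1 + ε) * K * (ε * B) ≤ ε * (1 + ε) * K * (ε * (1 + ε) * A + (1 + ε) * δ n) :=
        mul_le_mul_of_nonneg_left h2 (by positivity)
      have h7' : ε * (1 + ε) * G ≤ ε * (1 + ε) * (δ n * E) :=
        mul_le_mul_of_nonneg_left h3 (by positivity)
      nlinarith [h1', h5', h6', h7']
    -- let `n → ∞`
    have hlim : Tendsto (fun n => ε * (ε * ((1 + ε) ^ 2 * K * A)) +
        (ε * (1 + ε) ^ 2 * K + ε * (1 + ε) * E) * δ n) atTop
        (𝓝 (ε * (ε * ((1 + ε) ^ 2 * K * A)) + (ε * (1 + ε) ^ 2 * K + ε * (1 + ε) * E) * 0)) :=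
      tendsto_const_nhds.add (hδt.const_mul _)
    rw [mul_zero, add_zero] at hlim
    have hεT : ε * (ε * T) ≤ ε * (ε * ((1 + ε) ^ 2 * K * A)) :=
      ge_of_tendsto hlim (Eventually.of_forall comb)
    have hε2 : 0 < ε * ε := mul_pos hε hε
    nlinarith [hεT, hε2]
  -- let `ε → 0⁺`
  have hcont : Tendsto (fun ε : ℝ => (1 + ε) ^ 2 * K * A) (𝓝[>] 0) (𝓝 ((1 + 0) ^ 2 * K * A)) := by
    refine tendsto_nhdsWithin_of_tendsto_nhds ?_
    exact ((continuous_const.add continuous_id).pow 2 |>.mul continuous_const |>.mul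
      continuous_const).tendsto 0
  simp only [add_zero, one_pow, one_mul] at hcont
  exact ge_of_tendsto hcont (eventually_nhdsWithin_of_forall fun ε hε => hε_ineq ε hε)

end DataLimit

end Torus

end Literature.Analysis.FunctionSpaces

end
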